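import Summits.AnomalousDissipation.AnomalousDissipation.Theorems.DenseLoudDesignerForces.Negative.WitnessAnatomy
import Literature.Analysis.FunctionSpaces.TorusSpaceTimeFields

/-!
# Negative knowledge for the crux `DenseLoudDesignerForces` (stmt-AnomalousDissipation-1143), XII-a: Fourier slices
# of a periodic witness in time (tools for the constant-flux law)

Certified copy of the first half of §15 of the cdisprove work file (generation 3): band-limitedness of the designer
force (`mFourierCoeff_force_eq_zero`); TIME-DIFFERENTIABILITY of the spatial Fourier coefficients of a jointly smooth
field, `d/dt û(t,k) = 𝓕(∂ₜu(t))(k)` (`hasDerivAt_mFourierCoeff`, differentiation under the integral over the compact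
torus) and their continuity; the low-mode energy `E_N(t) = ∑_{|k|≤N}‖û(t,k)‖²`, enstrophy `G_N` and the energy flux
`Π_N(t) = ∫⟪(u·∇)u, P_N u⟫` out of the Fourier ball (`lowEnergy`, `lowEnstrophy`, `flux`); `E_N' = 2∫⟪∂ₜu, P_N u⟫`
(`hasDerivAt_lowEnergy`, `lowEnergy_deriv_eq_pairing`) and `∫⟪v, ΔP_N v⟫ = -G_N`
(`integral_inner_laplacian_fourierTruncate`).  Used by `Negative.ConstantFlux`.  Supports stmt-AnomalousDissipation-1143.
-/

noncomputable section

namespace Summit.AnomalousDissipation.AnomalousDissipation.Theorems.DenseLoudDesignerForces.Negative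

open scoped BigOperators Topology ENNReal InnerProductSpace
open Filter Set MeasureTheory UnitAddTorus
open Literature.Analysis.FunctionSpaces Literature.Analysis.FluidPDE
open Summit.AnomalousDissipation.AnomalousDissipation.Theses.BaireTransfer

/-! ## §15 (first half) Fourier slices in time: coefficients, low-mode energy, flux -/

section Flux

variable {S : Finset (Fin 3 → ℤ)} {ν τ : ℝ} {c : ↥S → (EuclideanSpace ℂ (Fin 3))} {u : ℝ → (UnitAddTorus (Fin 3)) → (EuclideanSpace ℝ (Fin 3))} {p : ℝ → (UnitAddTorus (Fin 3)) → ℝ}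

/-- BAND-LIMITEDNESS OF THE DESIGNER FORCE: `f̂_c(k) = 0` off every frequency ball containing the stock
(`f_c = Re ∑_{k∈S} e_k P_k ĉ_k` has modes in `S ∪ -S` only). -/
theorem mFourierCoeff_force_eq_zero {N : ℕ} (hS : S ⊆ Torus.freqBall N) (c : ↥S → (EuclideanSpace ℂ (Fin 3))) {k : Fin 3 → ℤ}
    (hk : k ∉ Torus.freqBall N) : mFourierCoeff (EuclideanSpace.complexify ∘ force S c) k = 0 := by
  set g : (Fin 3 → ℤ) → (EuclideanSpace ℂ (Fin 3)) := fun k => Torus.lerayCoeff k (Torus.coeffExt S c k) with hg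
  have hG : Integrable (Torus.trigPoly S g) volume := (Torus.continuous_trigPoly S g).integrable_unitAddTorus
  have hF : (EuclideanSpace.complexify ∘ force S c) =
      (EuclideanSpace.complexify ∘ fun x => EuclideanSpace.realPart (Torus.trigPoly S g x)) := rfl
  have hk1 : k ∉ S := fun h => hk (hS h)
  have hk2 : -k ∉ S := fun h => hk (Torus.neg_mem_freqBall.1 (hS h))
  rw [hF, Torus.mFourierCoeff_complexify_realPart_comp hG, Torus.mFourierCoeff_trigPoly,
    Torus.mFourierCoeff_trigPoly, if_neg hk1, if_neg hk2, EuclideanSpace.conjVec_zero, add_zero, smul_zero]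

/-- TIME-DIFFERENTIABILITY OF THE SPATIAL FOURIER COEFFICIENTS of a jointly smooth field:
`d/dt û(t,k) = 𝓕(∂ₜu(t))(k)` (differentiation under the integral over the compact torus). -/
theorem hasDerivAt_mFourierCoeff (hu : Torus.IsSmoothSpaceTimeOn univ u) (k : Fin 3 → ℤ) (t : ℝ) :
    HasDerivAt (fun s => mFourierCoeff (EuclideanSpace.complexify ∘ u s) k)
      (mFourierCoeff (EuclideanSpace.complexify ∘ Torus.timeDerivWithin univ u t) k) t := by
  set w : ℝ → (UnitAddTorus (Fin 3)) → (EuclideanSpace ℂ (Fin 3)) := fun s x => (mFourier (-k) x : ℂ) • EuclideanSpace.complexify (u s x) with hw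
  have hcu : Torus.IsSmoothSpaceTimeOn univ (fun s x => EuclideanSpace.complexify (u s x)) :=
    hu.clm_comp EuclideanSpace.complexify.toContinuousLinearMap
  have he : Torus.IsSmoothSpaceTimeOn univ (fun (_ : ℝ) (x : (UnitAddTorus (Fin 3))) => (mFourier (-k) x : ℂ)) :=
    Torus.isSmoothSpaceTimeOn_const (Torus.isSmooth_mFourier (-k)) univ
  have hw_st : Torus.IsSmoothSpaceTimeOn univ w := ContDiffOn.smul he hcu
  have hD := hw_st.hasDerivWithinAt_integral convex_univ (mem_univ t)
  have hslice : ∀ x, Torus.timeDerivWithin univ w t x =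
      (mFourier (-k) x : ℂ) • EuclideanSpace.complexify (Torus.timeDerivWithin univ u t x) := by
    intro x
    have h1 : HasDerivWithinAt (fun s => u s x) (Torus.timeDerivWithin univ u t x) univ t :=
      hu.hasDerivWithinAt_slice (mem_univ t) x
    have h2 : HasDerivWithinAt (fun s => EuclideanSpace.complexify (u s x))
        (EuclideanSpace.complexify (Torus.timeDerivWithin univ u t x)) univ t := by
      have := (EuclideanSpace.complexify (ι := Fin 3)).toContinuousLinearMap.hasFDerivAt.comp_hasDerivWithinAt t h1
      simpa [Function.comp_def] using this
    have h3 := h2.const_smul (mFourier (-k) x : ℂ)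
    show derivWithin (fun s => (mFourier (-k) x : ℂ) • EuclideanSpace.complexify (u s x)) univ t = _
    exact h3.derivWithin (uniqueDiffWithinAt_univ)
  have hint_eq : (∫ x, Torus.timeDerivWithin univ w t x) =
      mFourierCoeff (EuclideanSpace.complexify ∘ Torus.timeDerivWithin univ u t) k := by
    rw [Torus.mFourierCoeff_eq_integral_volume]
    exact integral_congr_ae (ae_of_all _ fun x => hslice x)
  have hfun : (fun s => ∫ x, w s x) = fun s => mFourierCoeff (EuclideanSpace.complexify ∘ u s) k := by
    funext s
    rw [Torus.mFourierCoeff_eq_integral_volume]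
    rfl
  rw [hfun, hint_eq] at hD
  exact hD.hasDerivAt univ_mem

/-- The spatial Fourier coefficients of a jointly smooth field are continuous in time. -/
theorem continuous_mFourierCoeff_slice (hu : Torus.IsSmoothSpaceTimeOn univ u) (k : Fin 3 → ℤ) :
    Continuous fun t => mFourierCoeff (EuclideanSpace.complexify ∘ u t) k :=
  continuousOn_univ.1 (Torus.continuousOn_mFourierCoeff_of_continuousOn_stLift hu.continuousOn_stLift k)

/-- The LOW-MODE ENERGY `E_N(t) = ∑_{|k|≤N} ‖û(t,k)‖²` (`= ∫‖P_N u(t)‖²`). -/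
def lowEnergy (N : ℕ) (u : ℝ → (UnitAddTorus (Fin 3)) → (EuclideanSpace ℝ (Fin 3))) (t : ℝ) : ℝ :=
  ∑ k ∈ Torus.freqBall N, ‖mFourierCoeff (EuclideanSpace.complexify ∘ u t) k‖ ^ 2

/-- The LOW-MODE ENSTROPHY `G_N(t) = 4π² ∑_{|k|≤N} |k|² ‖û(t,k)‖²` (`= ‖∇P_N u(t)‖₂²`). -/
def lowEnstrophy (N : ℕ) (u : ℝ → (UnitAddTorus (Fin 3)) → (EuclideanSpace ℝ (Fin 3))) (t : ℝ) : ℝ :=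
  4 * Real.pi ^ 2 * ∑ k ∈ Torus.freqBall N,
    Torus.freqNormSq k * ‖mFourierCoeff (EuclideanSpace.complexify ∘ u t) k‖ ^ 2

/-- The ENERGY FLUX out of the frequency ball `|k| ≤ N`: `Π_N(t) = ∫⟪(u·∇)u, P_N u⟫` — the rate at which the
triadic interactions drain the low modes (`= -∫⟪u ⊗ u : ∇P_N u⟫`, the Reynolds stress working against the
strain of the low-pass field). -/
def flux (N : ℕ) (u : ℝ → (UnitAddTorus (Fin 3)) → (EuclideanSpace ℝ (Fin 3))) (t : ℝ) : ℝ :=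
  ∫ x, ⟪Torus.convect (u t) (u t) x, Torus.fourierTruncate N (u t) x⟫_ℝ

/-- `E_N(t) = ∫‖P_N u(t)‖²`. -/
theorem lowEnergy_eq_integral (hu : Torus.IsSmoothSpaceTimeOn univ u) (N : ℕ) (t : ℝ) :
    lowEnergy N u t = ∫ x, ‖Torus.fourierTruncate N (u t) x‖ ^ 2 :=
  (Torus.integral_norm_sq_fourierTruncate (hu.isSmooth_slice (mem_univ t)).integrable N).symm

/-- `E_N(t) ≤ ∫‖u(t)‖²` (Bessel). -/
theorem lowEnergy_le (hu : Torus.IsSmoothSpaceTimeOn univ u) (N : ℕ) (t : ℝ) :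
    lowEnergy N u t ≤ ∫ x, ‖u t x‖ ^ 2 := by
  rw [lowEnergy_eq_integral hu]
  exact Torus.integral_norm_sq_fourierTruncate_le ((hu.isSmooth_slice (mem_univ t)).memLp 2) N

/-- `0 ≤ G_N(t)`. -/
theorem lowEnstrophy_nonneg (N : ℕ) (u : ℝ → (UnitAddTorus (Fin 3)) → (EuclideanSpace ℝ (Fin 3))) (t : ℝ) : 0 ≤ lowEnstrophy N u t := by
  unfold lowEnstrophy
  refine mul_nonneg (by positivity) (Finset.sum_nonneg fun k _ => mul_nonneg (Torus.freqNormSq_nonneg k) (sq_nonneg _))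

/-- Bernstein on the ball: `G_N(t) ≤ 4π²N² E_N(t)`. -/
theorem lowEnstrophy_le (N : ℕ) (u : ℝ → (UnitAddTorus (Fin 3)) → (EuclideanSpace ℝ (Fin 3))) (t : ℝ) :
    lowEnstrophy N u t ≤ 4 * Real.pi ^ 2 * (N : ℝ) ^ 2 * lowEnergy N u t := by
  unfold lowEnstrophy lowEnergy
  have h : ∑ k ∈ Torus.freqBall N, Torus.freqNormSq k * ‖mFourierCoeff (EuclideanSpace.complexify ∘ u t) k‖ ^ 2 ≤
      ∑ k ∈ Torus.freqBall N, (N : ℝ) ^ 2 * ‖mFourierCoeff (EuclideanSpace.complexify ∘ u t) k‖ ^ 2 :=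
    Finset.sum_le_sum fun k hk => mul_le_mul_of_nonneg_right (Torus.mem_freqBall.1 hk) (sq_nonneg _)
  have hpi : 0 ≤ 4 * Real.pi ^ 2 := by positivity
  calc 4 * Real.pi ^ 2 * ∑ k ∈ Torus.freqBall N, Torus.freqNormSq k * ‖mFourierCoeff (EuclideanSpace.complexify ∘ u t) k‖ ^ 2
      ≤ 4 * Real.pi ^ 2 * ∑ k ∈ Torus.freqBall N, (N : ℝ) ^ 2 * ‖mFourierCoeff (EuclideanSpace.complexify ∘ u t) k‖ ^ 2 :=
        mul_le_mul_of_nonneg_left h hpi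
    _ = 4 * Real.pi ^ 2 * (N : ℝ) ^ 2 * ∑ k ∈ Torus.freqBall N, ‖mFourierCoeff (EuclideanSpace.complexify ∘ u t) k‖ ^ 2 := by
        rw [← Finset.mul_sum]; ring

/-- `d/dt ‖û(t,k)‖² = 2 Re⟪𝓕(∂ₜu(t))(k), û(t,k)⟫_ℂ`. -/
theorem hasDerivAt_norm_sq_mFourierCoeff (hu : Torus.IsSmoothSpaceTimeOn univ u) (k : Fin 3 → ℤ) (t : ℝ) :
    HasDerivAt (fun s => ‖mFourierCoeff (EuclideanSpace.complexify ∘ u s) k‖ ^ 2)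
      (2 * (inner ℂ (mFourierCoeff (EuclideanSpace.complexify ∘ Torus.timeDerivWithin univ u t) k)
        (mFourierCoeff (EuclideanSpace.complexify ∘ u t) k)).re) t := by
  have hf := hasDerivAt_mFourierCoeff hu k t
  have h2 := Complex.reCLM.hasFDerivAt.comp_hasDerivAt t (hf.inner ℂ hf)
  have hfun : (fun s => ‖mFourierCoeff (EuclideanSpace.complexify ∘ u s) k‖ ^ 2) =
      (⇑Complex.reCLM ∘ fun s => ⟪mFourierCoeff (EuclideanSpace.complexify ∘ u s) k,
        mFourierCoeff (EuclideanSpace.complexify ∘ u s) k⟫_ℂ) := by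
    funext s
    simp only [Function.comp_apply, Complex.reCLM_apply]
    rw [← inner_self_eq_norm_sq (𝕜 := ℂ), RCLike.re_to_complex]
  rw [hfun]
  refine h2.congr_deriv ?_
  rw [Complex.reCLM_apply, Complex.add_re,
    ← inner_conj_symm _ (mFourierCoeff (EuclideanSpace.complexify ∘ Torus.timeDerivWithin univ u t) k),
    Complex.conj_re]
  ring

/-- `d/dt E_N(t) = 2 ∑_{|k|≤N} Re⟪𝓕(∂ₜu(t))(k), û(t,k)⟫_ℂ`. -/
theorem hasDerivAt_lowEnergy (hu : Torus.IsSmoothSpaceTimeOn univ u) (N : ℕ) (t : ℝ) :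
    HasDerivAt (lowEnergy N u)
      (∑ k ∈ Torus.freqBall N,
        2 * (inner ℂ (mFourierCoeff (EuclideanSpace.complexify ∘ Torus.timeDerivWithin univ u t) k)
          (mFourierCoeff (EuclideanSpace.complexify ∘ u t) k)).re) t := by
  unfold lowEnergy
  exact HasDerivAt.fun_sum fun k _ => hasDerivAt_norm_sq_mFourierCoeff hu k t

/-- Symmetry of the truncation against smooth fields: `∫⟪P_N a, b⟫ = ∫⟪a, P_N b⟫`. -/
theorem integral_inner_fourierTruncate_symm {a b : (UnitAddTorus (Fin 3)) → (EuclideanSpace ℝ (Fin 3))} (ha : Torus.IsSmooth a) (hb : Torus.IsSmooth b)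
    (N : ℕ) :
    ∫ x, ⟪Torus.fourierTruncate N a x, b x⟫_ℝ = ∫ x, ⟪a x, Torus.fourierTruncate N b x⟫_ℝ := by
  rw [Torus.integral_inner_fourierTruncate_left ha.integrable (hb.memLp 2),
    show (∫ x, ⟪a x, Torus.fourierTruncate N b x⟫_ℝ) = ∫ x, ⟪Torus.fourierTruncate N b x, a x⟫_ℝ from
      integral_congr_ae (ae_of_all _ fun x => real_inner_comm _ _),
    Torus.integral_inner_fourierTruncate_left hb.integrable (ha.memLp 2)]
  refine Finset.sum_congr rfl fun k _ => ?_
  rw [← inner_conj_symm, Complex.conj_re]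

/-- `d/dt E_N(t) = 2∫⟪∂ₜu(t), P_N u(t)⟫`. -/
theorem lowEnergy_deriv_eq_pairing (hu : Torus.IsSmoothSpaceTimeOn univ u) (N : ℕ) (t : ℝ) :
    (∑ k ∈ Torus.freqBall N,
        2 * (inner ℂ (mFourierCoeff (EuclideanSpace.complexify ∘ Torus.timeDerivWithin univ u t) k)
          (mFourierCoeff (EuclideanSpace.complexify ∘ u t) k)).re) =
      2 * ∫ x, ⟪Torus.timeDerivWithin univ u t x, Torus.fourierTruncate N (u t) x⟫_ℝ := by
  have hut : Torus.IsSmooth (u t) := hu.isSmooth_slice (mem_univ t)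
  have hdt : Torus.IsSmooth (Torus.timeDerivWithin univ u t) :=
    (hu.timeDerivWithin uniqueDiffOn_univ).isSmooth_slice (mem_univ t)
  rw [← Finset.mul_sum, ← integral_inner_fourierTruncate_symm hdt hut N,
    Torus.integral_inner_fourierTruncate_left hdt.integrable (hut.memLp 2)]

/-- `∫⟪v, Δ P_N v⟫ = -G_N`: the Laplacian of the truncation pairs with the field to minus the low-mode enstrophy. -/
theorem integral_inner_laplacian_fourierTruncate {v : (UnitAddTorus (Fin 3)) → (EuclideanSpace ℝ (Fin 3))} (hv : Torus.IsSmooth v) (N : ℕ) :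
    ∫ x, ⟪v x, Torus.laplacian (Torus.fourierTruncate N v) x⟫_ℝ =
      -(4 * Real.pi ^ 2 * ∑ k ∈ Torus.freqBall N,
        Torus.freqNormSq k * ‖mFourierCoeff (EuclideanSpace.complexify ∘ v) k‖ ^ 2) := by
  set a : (Fin 3 → ℤ) → (EuclideanSpace ℂ (Fin 3)) := fun k => mFourierCoeff (EuclideanSpace.complexify ∘ v) k with ha
  have hac : Torus.IsConjSymm a := Torus.isConjSymm_mFourierCoeff hv.integrable
  set g : (Fin 3 → ℤ) → (EuclideanSpace ℂ (Fin 3)) := fun k => -(((4 * Real.pi ^ 2 * Torus.freqNormSq k : ℝ) : ℂ) • a k) with hg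
  have hlap : Torus.laplacian (Torus.fourierTruncate N v) = Torus.realTrigPoly (Torus.freqBall N) g := by
    funext x
    rw [Torus.fourierTruncate_eq, Torus.laplacian_realTrigPoly]
  have hgc : Torus.IsConjSymm g := by
    intro k
    simp only [hg]
    rw [Torus.freqNormSq_neg, hac k, EuclideanSpace.conjVec_neg, EuclideanSpace.conjVec_smul, Complex.conj_ofReal]
  rw [hlap, show (∫ x, ⟪v x, Torus.realTrigPoly (Torus.freqBall N) g x⟫_ℝ) =
      ∫ x, ⟪Torus.realTrigPoly (Torus.freqBall N) g x, v x⟫_ℝ from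
      integral_congr_ae (ae_of_all _ fun x => real_inner_comm _ _),
    Torus.integral_inner_realTrigPoly_left Torus.neg_mem_freqBall_of_mem hgc (hv.memLp 2),
    Finset.mul_sum, ← Finset.sum_neg_distrib]
  refine Finset.sum_congr rfl fun k _ => ?_
  simp only [hg, ha]
  have hself : (⟪mFourierCoeff (EuclideanSpace.complexify ∘ v) k, mFourierCoeff (EuclideanSpace.complexify ∘ v) k⟫_ℂ).re =
      ‖mFourierCoeff (EuclideanSpace.complexify ∘ v) k‖ ^ 2 := by
    rw [← inner_self_eq_norm_sq (𝕜 := ℂ), RCLike.re_to_complex]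
  rw [inner_neg_left, Complex.neg_re, inner_smul_left, Complex.conj_ofReal, Complex.re_ofReal_mul, hself]
  ring


end Flux

end Summit.AnomalousDissipation.AnomalousDissipation.Theorems.DenseLoudDesignerForces.Negative

end
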